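import Mathlib.Analysis.Calculus.AbsolutelyMonotone
import Mathlib.Analysis.Calculus.Taylor
import Mathlib.Analysis.Calculus.Deriv.MeanValue
import Mathlib.Topology.Algebra.InfiniteSum.ENNReal
import HarnessLib

/-!
# Bernstein's little theorem: an absolutely monotonic function is the sum of its Taylor series
(Widder, *The Laplace Transform*, Chapter IV, Theorem 3a)

**Theorem (S. Bernstein; Widder 1941, Ch. IV, Thm. 3a).** If `f` is absolutely monotonic on
`[x₀, b)` (all derivatives exist and are `≥ 0` there; Mathlib: `AbsolutelyMonotoneOn f (Set.Ico x₀ b)`),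
then for every `x ∈ [x₀, b)`
`f(x) = Σ_{k ≥ 0} f^{(k)}(x₀) (x - x₀)^k / k!`,
a convergent series of nonnegative terms. (Widder states the stronger conclusion that `f` extends
analytically to the disc `|z - x₀| < b - x₀`; what is here is the real-variable convergence on
`[x₀, b)`, which is what identifies the absolutely monotonic potentials of Cohn–Kumar 2007 with the
nonnegative power series in `1 + t`.)

*Proof (as printed, loc. cit.).* Taylor's formula with the exact (integral) remainder,
`R_n(x) = ∫_{x₀}^{x} (x-t)^n/n! · f^{(n+1)}(t) dt`; since `f^{(n+2)} ≥ 0`, `f^{(n+1)}` is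
non-decreasing, so after the substitution `t = x₀ + λ(s - x₀)`, `λ = (x-x₀)/(c-x₀)`, one gets for
`x₀ ≤ x < c < b`: `0 ≤ R_n(x) ≤ λ^{n+1} R_n(c) ≤ λ^{n+1} f(c) → 0`.

What is here: `absolutelyMonotoneOn_taylor_remainder_le` (the displayed inequality),
`absolutelyMonotoneOn_hasSum_taylor` (the theorem), and the packaging used by the energy files of
`Summits/Ventures/PackingBounds/Energy/`: `absolutelyMonotoneOn_hasSum_one_add`
(on `[-1,1)`: `f(s) = Σ c_k (1+s)^k` with `c_k ≥ 0`).

## References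
* D. V. Widder, *The Laplace Transform*, Princeton Univ. Press, 1941, Chapter IV §3, Theorem 3a.
  [`Widder1941`]
* S. Bernstein, *Sur les fonctions absolument monotones*, Acta Math. 52 (1929) 1–66.
-/

noncomputable section

open Set MeasureTheory intervalIntegral Filter
open scoped Topology ContDiff

namespace Literature.Analysis.Calculus

namespace AbsolutelyMonotonePowerSeries

variable {f : ℝ → ℝ} {x₀ b : ℝ}

/-- On a closed subinterval `[x₀, x] ⊆ [x₀, b)` the iterated derivatives within `[x₀, x]` agree with
those within `[x₀, b)`. [folklore] -/
private theorem iteratedDerivWithin_Icc_eq (hf : ContDiffOn ℝ ∞ f (Ico x₀ b)) {x : ℝ} (hx₀ : x₀ < x)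
    (hxb : x < b) (m : ℕ) {u : ℝ} (hu : u ∈ Icc x₀ x) :
    iteratedDerivWithin m f (Icc x₀ x) u = iteratedDerivWithin m f (Ico x₀ b) u := by
  rw [iteratedDerivWithin_eq_iteratedFDerivWithin, iteratedDerivWithin_eq_iteratedFDerivWithin,
    iteratedFDerivWithin_subset (Icc_subset_Ico_right hxb) (uniqueDiffOn_Icc hx₀)
      (uniqueDiffOn_Ico x₀ b) (hf.of_le (mod_cast le_top)) hu]

/-- Taylor's formula with integral remainder for an absolutely monotonic (indeed any `C^∞`) function on
`[x₀, b)`, with all derivatives taken within `[x₀, b)` (formula (1) of the cited proof).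
[cite: Widder1941, Chapter IV, Theorem 3a (proof, formula (1))] -/
theorem taylor_integral (hf : ContDiffOn ℝ ∞ f (Ico x₀ b)) {x : ℝ} (hx₀ : x₀ < x) (hxb : x < b)
    (n : ℕ) :
    f x - ∑ k ∈ Finset.range (n + 1),
        iteratedDerivWithin k f (Ico x₀ b) x₀ / (Nat.factorial k) * (x - x₀) ^ k =
      ∫ u in x₀..x, (x - u) ^ n / (Nat.factorial n) *
        iteratedDerivWithin (n + 1) f (Ico x₀ b) u := by
  have hI : uIcc x₀ x = Icc x₀ x := uIcc_of_le hx₀.le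
  have hcd : ContDiffOn ℝ (n + 1 : ℕ) f (uIcc x₀ x) := by
    rw [hI]; exact (hf.mono (Icc_subset_Ico_right hxb)).of_le (mod_cast le_top)
  have h := taylor_integral_remainder hcd
  rw [taylor_within_apply] at h
  have hsum : ∑ k ∈ Finset.range (n + 1), (((Nat.factorial k : ℝ))⁻¹ * (x - x₀) ^ k) •
      iteratedDerivWithin k f (uIcc x₀ x) x₀ = ∑ k ∈ Finset.range (n + 1),
        iteratedDerivWithin k f (Ico x₀ b) x₀ / (Nat.factorial k) * (x - x₀) ^ k := by
    refine Finset.sum_congr rfl fun k _ => ?_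
    rw [hI, iteratedDerivWithin_Icc_eq hf hx₀ hxb k (left_mem_Icc.2 hx₀.le), smul_eq_mul]
    ring
  rw [hsum] at h
  rw [h]
  refine intervalIntegral.integral_congr fun u hu => ?_
  rw [hI] at hu
  simp only [smul_eq_mul]
  rw [hI, iteratedDerivWithin_Icc_eq hf hx₀ hxb (n + 1) hu]

/-- Each iterated derivative (within `[x₀, b)`) of an absolutely monotonic function is non-decreasing
on `[x₀, b)` (its derivative `f^{(m+1)} ≥ 0`). [cite: Widder1941, Chapter IV, Theorem 3a (proof)] -/
theorem monotoneOn_iteratedDerivWithin (hf : AbsolutelyMonotoneOn f (Ico x₀ b)) (m : ℕ) :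
    MonotoneOn (iteratedDerivWithin m f (Ico x₀ b)) (Ico x₀ b) := by
  have hS := uniqueDiffOn_Ico x₀ b
  have hcd := hf.contDiffOn
  refine monotoneOn_of_deriv_nonneg (convex_Ico x₀ b)
    (hcd.continuousOn_iteratedDerivWithin (mod_cast le_top) hS) ?_ ?_
  · rw [interior_Ico]
    intro y hy
    exact ((hcd.differentiableOn_iteratedDerivWithin (mod_cast ENat.coe_lt_top m) hS) y
      (Ioo_subset_Ico_self hy)).differentiableAt (Ico_mem_nhds hy.1 hy.2) |>.differentiableWithinAt
  · rw [interior_Ico]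
    intro y hy
    have hyS : y ∈ Ico x₀ b := Ioo_subset_Ico_self hy
    rw [← derivWithin_of_mem_nhds (Ico_mem_nhds hy.1 hy.2), ← iteratedDerivWithin_succ]
    exact hf.iteratedDerivWithin_nonneg hS (m + 1) hyS

/-- **The remainder estimate of Widder's proof**: for `x₀ ≤ x < c < b`,
`∫_{x₀}^{x} (x-u)^n/n! f^{(n+1)}(u) du ≤ ((x-x₀)/(c-x₀))^{n+1} ∫_{x₀}^{c} (c-u)^n/n! f^{(n+1)}(u) du`.
[cite: Widder1941, Chapter IV, Theorem 3a (proof)] -/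
theorem remainder_le (hf : AbsolutelyMonotoneOn f (Ico x₀ b)) {x c : ℝ} (hx₀ : x₀ < x)
    (hxc : x < c) (hcb : c < b) (n : ℕ) :
    ∫ u in x₀..x, (x - u) ^ n / (Nat.factorial n) * iteratedDerivWithin (n + 1) f (Ico x₀ b) u ≤
      ((x - x₀) / (c - x₀)) ^ (n + 1) *
        ∫ u in x₀..c, (c - u) ^ n / (Nat.factorial n) * iteratedDerivWithin (n + 1) f (Ico x₀ b) u := by
  set D := iteratedDerivWithin (n + 1) f (Ico x₀ b) with hDdef
  set l : ℝ := (x - x₀) / (c - x₀) with hl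
  have hcx₀ : 0 < c - x₀ := by linarith
  have hl0 : 0 < l := div_pos (by linarith) hcx₀
  have hl1 : l < 1 := (div_lt_one hcx₀).2 (by linarith)
  have hS := uniqueDiffOn_Ico x₀ b
  have hDcont : ContinuousOn D (Ico x₀ b) :=
    hf.contDiffOn.continuousOn_iteratedDerivWithin (mod_cast le_top) hS
  have hDmono := monotoneOn_iteratedDerivWithin hf (n + 1)
  -- substitution `u = l * w + (x₀ - l * x₀)` maps `[x₀, c]` onto `[x₀, x]`
  have hsub : ∫ u in x₀..x, (x - u) ^ n / (Nat.factorial n) * D u =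
      l * ∫ w in x₀..c, (x - (l * w + (x₀ - l * x₀))) ^ n / (Nat.factorial n) *
        D (l * w + (x₀ - l * x₀)) := by
    rw [intervalIntegral.integral_comp_mul_add (fun u => (x - u) ^ n / (Nat.factorial n) * D u)
      hl0.ne' (x₀ - l * x₀)]
    have h1 : l * x₀ + (x₀ - l * x₀) = x₀ := by ring
    have h2 : l * c + (x₀ - l * x₀) = x := by rw [hl]; field_simp; ring
    rw [h1, h2, smul_eq_mul, ← mul_assoc, mul_inv_cancel₀ hl0.ne', one_mul]
  rw [hsub]
  -- pointwise comparison of the integrands on `[x₀, c]`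
  have hpt : ∀ w ∈ Icc x₀ c, (x - (l * w + (x₀ - l * x₀))) ^ n / (Nat.factorial n) *
      D (l * w + (x₀ - l * x₀)) ≤ l ^ n * ((c - w) ^ n / (Nat.factorial n) * D w) := by
    intro w hw
    have hxw : x - (l * w + (x₀ - l * x₀)) = l * (c - w) := by rw [hl]; field_simp; ring
    rw [hxw, mul_pow]
    have hw1 : x₀ ≤ l * w + (x₀ - l * x₀) := by nlinarith [hw.1, hl0.le]
    have hw2 : l * w + (x₀ - l * x₀) ≤ w := by nlinarith [hw.1, hl1.le]
    have hwS : w ∈ Ico x₀ b := ⟨hw.1, lt_of_le_of_lt hw.2 hcb⟩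
    have hmS : l * w + (x₀ - l * x₀) ∈ Ico x₀ b := ⟨hw1, lt_of_le_of_lt (hw2.trans hw.2) hcb⟩
    have hDle : D (l * w + (x₀ - l * x₀)) ≤ D w := hDmono hmS hwS hw2
    have hDnn : 0 ≤ D (l * w + (x₀ - l * x₀)) := hf.iteratedDerivWithin_nonneg hS (n + 1) hmS
    have hcw : 0 ≤ (c - w) ^ n / (Nat.factorial n) := by
      have : 0 ≤ c - w := by linarith [hw.2]
      positivity
    calc l ^ n * (c - w) ^ n / (Nat.factorial n) * D (l * w + (x₀ - l * x₀))
          = l ^ n * ((c - w) ^ n / (Nat.factorial n) * D (l * w + (x₀ - l * x₀))) := by ring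
      _ ≤ l ^ n * ((c - w) ^ n / (Nat.factorial n) * D w) :=
          mul_le_mul_of_nonneg_left (mul_le_mul_of_nonneg_left hDle hcw) (pow_nonneg hl0.le n)
  -- integrability (continuity) of both integrands on `[x₀, c]`
  have hcont1 : ContinuousOn (fun w => (x - (l * w + (x₀ - l * x₀))) ^ n / (Nat.factorial n) *
      D (l * w + (x₀ - l * x₀))) (uIcc x₀ c) := by
    rw [uIcc_of_le (by linarith : x₀ ≤ c)]
    refine ContinuousOn.mul (by fun_prop) ?_
    refine hDcont.comp (by fun_prop) fun w hw => ?_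
    exact ⟨by nlinarith [hw.1, hl0.le], lt_of_le_of_lt
      ((by nlinarith [hw.1, hl1.le] : l * w + (x₀ - l * x₀) ≤ w).trans hw.2) hcb⟩
  have hcont2 : ContinuousOn (fun w => l ^ n * ((c - w) ^ n / (Nat.factorial n) * D w))
      (uIcc x₀ c) := by
    rw [uIcc_of_le (by linarith : x₀ ≤ c)]
    refine ContinuousOn.mul (by fun_prop) (ContinuousOn.mul (by fun_prop) ?_)
    exact hDcont.mono fun w hw => ⟨hw.1, lt_of_le_of_lt hw.2 hcb⟩
  have hmono := intervalIntegral.integral_mono_on (μ := volume) (by linarith : x₀ ≤ c)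
    hcont1.intervalIntegrable hcont2.intervalIntegrable hpt
  rw [intervalIntegral.integral_const_mul] at hmono
  calc l * ∫ w in x₀..c, (x - (l * w + (x₀ - l * x₀))) ^ n / (Nat.factorial n) *
        D (l * w + (x₀ - l * x₀))
        ≤ l * (l ^ n * ∫ w in x₀..c, (c - w) ^ n / (Nat.factorial n) * D w) :=
          mul_le_mul_of_nonneg_left hmono hl0.le
    _ = l ^ (n + 1) * ∫ w in x₀..c, (c - w) ^ n / (Nat.factorial n) * D w := by ring

/-- **Bernstein's little theorem (Widder, Ch. IV, Thm. 3a).** An absolutely monotonic function on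
`[x₀, b)` is the sum of its Taylor series at `x₀` on the whole of `[x₀, b)`:
`HasSum (k ↦ f^{(k)}(x₀)/k! · (x - x₀)^k) (f x)`, the derivatives being taken within `[x₀, b)`
(one-sided at `x₀`). [cite: Widder1941, Chapter IV, Theorem 3a] -/
theorem hasSum_taylor (hf : AbsolutelyMonotoneOn f (Ico x₀ b)) {x : ℝ} (hx : x ∈ Ico x₀ b) :
    HasSum (fun k => iteratedDerivWithin k f (Ico x₀ b) x₀ / (Nat.factorial k) * (x - x₀) ^ k)
      (f x) := by
  have hS := uniqueDiffOn_Ico x₀ b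
  have hx₀S : x₀ ∈ Ico x₀ b := ⟨le_rfl, lt_of_le_of_lt hx.1 hx.2⟩
  have hck : ∀ k, 0 ≤ iteratedDerivWithin k f (Ico x₀ b) x₀ / (Nat.factorial k) := fun k =>
    div_nonneg (hf.iteratedDerivWithin_nonneg hS k hx₀S) (Nat.cast_nonneg _)
  rcases eq_or_lt_of_le hx.1 with h0 | hx₀
  · -- `x = x₀`: only the constant term survives
    subst h0
    have hval : (fun k => iteratedDerivWithin k f (Ico x₀ b) x₀ / (Nat.factorial k) *
        (x₀ - x₀) ^ k) 0 = f x₀ := by simp [iteratedDerivWithin_zero]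
    rw [← hval]
    refine hasSum_single 0 fun k hk => ?_
    simp [zero_pow hk]
  -- `x₀ < x < b`
  have hterm : ∀ k, 0 ≤ iteratedDerivWithin k f (Ico x₀ b) x₀ / (Nat.factorial k) * (x - x₀) ^ k :=
    fun k => mul_nonneg (hck k) (pow_nonneg (by linarith) k)
  rw [hasSum_iff_tendsto_nat_of_nonneg hterm]
  -- partial sums `S_{n+1} = f x - R_n` with `0 ≤ R_n ≤ l^{n+1} f(c)`, `l < 1`
  set c : ℝ := (x + b) / 2 with hc
  have hxc : x < c := by rw [hc]; linarith [hx.2]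
  have hcb : c < b := by rw [hc]; linarith [hx.2]
  have hcS : c ∈ Ico x₀ b := ⟨by linarith, hcb⟩
  set l : ℝ := (x - x₀) / (c - x₀) with hl
  have hl0 : 0 ≤ l := div_nonneg (by linarith) (by linarith)
  have hl1 : l < 1 := (div_lt_one (by linarith)).2 (by linarith)
  set R : ℕ → ℝ := fun n => ∫ u in x₀..x, (x - u) ^ n / (Nat.factorial n) *
    iteratedDerivWithin (n + 1) f (Ico x₀ b) u with hR
  have hcd := hf.contDiffOn
  have hpartial : ∀ n, ∑ k ∈ Finset.range (n + 1),
      iteratedDerivWithin k f (Ico x₀ b) x₀ / (Nat.factorial k) * (x - x₀) ^ k = f x - R n := by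
    intro n
    have h := taylor_integral hcd hx₀ hx.2 n
    rw [hR]; linarith
  -- `0 ≤ R n`
  have hR0 : ∀ n, 0 ≤ R n := fun n => by
    rw [hR]
    refine intervalIntegral.integral_nonneg hx₀.le fun u hu => mul_nonneg ?_ ?_
    · have : 0 ≤ x - u := by linarith [hu.2]
      positivity
    · exact hf.iteratedDerivWithin_nonneg hS (n + 1) ⟨hu.1, lt_of_le_of_lt hu.2 hx.2⟩
  -- `R n ≤ l^{n+1} f c`
  have hRle : ∀ n, R n ≤ l ^ (n + 1) * f c := by
    intro n
    have h1 := remainder_le hf hx₀ hxc hcb n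
    have h2 : ∫ u in x₀..c, (c - u) ^ n / (Nat.factorial n) *
        iteratedDerivWithin (n + 1) f (Ico x₀ b) u ≤ f c := by
      have h := taylor_integral hcd (hx₀.trans hxc) hcb n
      have hsum : 0 ≤ ∑ k ∈ Finset.range (n + 1),
          iteratedDerivWithin k f (Ico x₀ b) x₀ / (Nat.factorial k) * (c - x₀) ^ k :=
        Finset.sum_nonneg fun k _ => mul_nonneg (hck k) (pow_nonneg (by linarith) k)
      linarith
    exact h1.trans (mul_le_mul_of_nonneg_left h2 (pow_nonneg hl0 _))
  -- conclude: partial sums → f x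
  have hlim : Tendsto (fun n => f x - R n) atTop (𝓝 (f x)) := by
    have hgeom : Tendsto (fun n => l ^ (n + 1) * f c) atTop (𝓝 0) := by
      have h := (tendsto_pow_atTop_nhds_zero_of_lt_one hl0 hl1).comp (tendsto_add_atTop_nat 1)
      simpa using h.mul_const (f c)
    have hR_tend : Tendsto R atTop (𝓝 0) :=
      tendsto_of_tendsto_of_tendsto_of_le_of_le tendsto_const_nhds hgeom hR0 hRle
    simpa using (tendsto_const_nhds (x := f x)).sub hR_tend
  have h' : Tendsto (fun n => ∑ k ∈ Finset.range (n + 1),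
      iteratedDerivWithin k f (Ico x₀ b) x₀ / (Nat.factorial k) * (x - x₀) ^ k) atTop (𝓝 (f x)) :=
    hlim.congr fun n => (hpartial n).symm
  exact (tendsto_add_atTop_iff_nat 1).1 h'

end AbsolutelyMonotonePowerSeries

open AbsolutelyMonotonePowerSeries in
/-- **Bernstein's little theorem, packaged for potentials of the inner product** (the form used by
Cohn–Kumar 2007, p. 5): a function absolutely monotonic on `[-1, 1)` is represented there by a
power series in `1 + t` with nonnegative coefficients: there are `c_k ≥ 0` with
`f(s) = Σ_k c_k (1 + s)^k` for `-1 ≤ s < 1`. [cite: Widder1941, Chapter IV, Theorem 3a] -/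
theorem absolutelyMonotoneOn_hasSum_one_add {f : ℝ → ℝ}
    (hf : AbsolutelyMonotoneOn f (Ico (-1) 1)) :
    ∃ c : ℕ → ℝ, (∀ k, 0 ≤ c k) ∧
      ∀ s : ℝ, -1 ≤ s → s < 1 → HasSum (fun k => c k * (1 + s) ^ k) (f s) := by
  refine ⟨fun k => iteratedDerivWithin k f (Ico (-1) 1) (-1) / (Nat.factorial k), fun k =>
    div_nonneg (hf.iteratedDerivWithin_nonneg (uniqueDiffOn_Ico (-1) 1) k
      ⟨le_rfl, by norm_num⟩) (Nat.cast_nonneg _), fun s hs1 hs2 => ?_⟩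
  have h := hasSum_taylor hf (x := s) ⟨hs1, hs2⟩
  simpa only [sub_neg_eq_add, add_comm s 1] using h

end Literature.Analysis.Calculus

end
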